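import Mathlib
import HarnessLib

/-!
# The unitary period domain: positive `p`-planes of the standard Hermitian space of
signature `(p, q)` and the type AIII bounded domain `{Z : ‖Z‖ < 1}`

Let `H₀((x₁, x₂), (y₁, y₂)) = ⟪x₁, y₁⟫ - ⟪x₂, y₂⟫` be the standard Hermitian form of signature
`(p, q)` on `ℂᵖ × ℂ^q` (Gohberg–Lancaster–Rodman, *Indefinite Linear Algebra and Applications*
(2005), §10.1, (10.1.2)). A subspace `M` is *`H₀`-positive* if `H₀(x, x) > 0` for every non-zero
`x ∈ M`, i.e. `‖x₂‖ < ‖x₁‖` on `M ∖ 0`; the maximal dimension of a positive subspace is `p`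
(loc. cit. Thm. 2.3.2), and the `p`-dimensional ("maximal") positive subspaces are exactly the
graphs `{(v, Z v)}` of the STRICT CONTRACTIONS `Z : ℂᵖ → ℂ^q`, `‖Z‖ < 1`, each in a unique way
(loc. cit. Lemma 10.1.2 with Cor. 10.1.4). The set of strict contractions
`I_{p,q} = {Z ∈ M_{q×p}(ℂ) : 1 - Z^*Z > 0}` is the bounded (Harish-Chandra) realisation of the
Hermitian symmetric domain `SU(p, q)/S(U(p) × U(q))` of type AIII (Carlson–Müller-Stach–Peters,
*Period Mappings and Period Domains*, 2nd ed., Thm. 16.1.5, after Helgason Ch. X §6.4): it is an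
open CONVEX subset of a complex vector space, in particular non-empty and path connected.

Everything in this file is PROVED (no named facts):

* `unitaryPeriodDomain p q = {Z : ℂᵖ →L[ℂ] ℂ^q | ∀ v ≠ 0, ‖Z v‖ < ‖v‖}` (pointwise strict
  contractions) equals the open unit ball of the operator norm (`unitaryPeriodDomain_eq_ball`; the
  non-trivial inclusion uses compactness of the unit sphere of `ℂᵖ`), hence is open, convex,
  non-empty, path connected and connected;
* `IsPositiveSubspace` / `IsPositivePlane` (positive of dimension `p`); every positive subspace has
  dimension `≤ p` (`finrank_le_of_isPositiveSubspace`, GLR Thm. 2.3.2);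
* the graph `graphPlane Z` is a positive `p`-plane iff `Z ∈ unitaryPeriodDomain p q`
  (`isPositivePlane_graphPlane_iff`), `graphPlane` is injective, and every positive `p`-plane is a graph
  (`exists_graphPlane_eq`): the bijection `unitaryPeriodDomainEquiv : unitaryPeriodDomain p q ≃ {positive p-planes}`
  (GLR Lemma 10.1.2 + Cor. 10.1.4, positive version);
* the matrix form: for `K ∈ M_{q×p}(ℂ)`, the map `v ↦ K v` lies in the domain iff `1 - Kᴴ K` is
  positive definite (`euclideanCLMOfMatrix_mem_unitaryPeriodDomain_iff`), i.e. the domain IS `I_{p,q}`.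

## Why this is here (Hodge theory of abelian varieties of Weil type)

In Deligne's proof that Weil–Hodge classes on abelian varieties of Weil type are absolutely Hodge
(LNM 900, proof of Thm. 4.8, pp. 48–51) the family of abelian varieties is parametrised by
`X⁺ = {K-linear complex structures J on V_ℝ, E(Jx, Jy) = E(x, y), E(x, Jx) > 0}`, "an open connected
complex submanifold of a product of Grassmannians" (p. 49), and the base of the algebraic family is
the arithmetic quotient `Γ\X⁺`; CONNECTEDNESS of `X⁺` is what makes that base irreducible and what
puts the period point of every other member `(A, φ)` of the same Hermitian type into the SAME
component (the reach clause of `Literature.AlgebraicGeometry.HodgeTheory.weilFamilyReach_hyperbolic`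
and of `…weilFamily_hyperbolic_weilSystem_reach`, whose reductions to the bare construction are
`HodgeTheory/WeilFamilyReachOfConstruction`, `…OfLevelConstruction`). For `K = ℚ(√-d)` acting on
`V` (`dim_ℚ V = 4n`) with `E(αx, αy) = d E(x, y)`: `V ⊗ ℂ = V₊ ⊕ V₋` (eigenspaces of `α`), `E_ℂ`
vanishes on `V₊ × V₊`, `H₊(u, v) := i E_ℂ(u, v̄)` is a Hermitian form on `V₊ ≅ ℂ^{2n}` whose
signature `(p, q)` is the type of `(V, K, E)` (van Geemen, LNM 1594, 5.2, 5.5–5.7), and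
`J ↦ V₊^{1,0}(J)` identifies `X⁺` with the `H₊`-positive `p`-planes of `V₊`, i.e. — after a unitary
frame of `(V₊, H₊)` — with the positive `p`-planes of the standard space of this file, i.e. with
`unitaryPeriodDomain p q ≅ SU(p, q)/S(U(p) × U(q))` (van Geemen 5.8–5.10: `H_n ≅ SU(n, n)/S(U(n) × U(n))`
for the hyperbolic type `(n, n)`). This file supplies the target of that identification and its
topology; the dictionary `J ↔ V₊^{1,0}(J)` itself is not formalised here.

## Design / not here

* Maps are continuous linear maps `EuclideanSpace ℂ (Fin p) →L[ℂ] EuclideanSpace ℂ (Fin q)` so that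
  the operator norm and its topology are available; matrices enter only through
  `euclideanCLMOfMatrix K := (Matrix.toEuclideanLin K).toContinuousLinearMap`.
* Not here: the dictionary with complex structures (above), transitivity of `SU(p, q)` on the domain,
  the Bergman metric, boundary components, Baily–Borel.

## References

* [GohbergLancasterRodman2005] I. Gohberg, P. Lancaster, L. Rodman, *Indefinite Linear Algebra and
  Applications*, Birkhäuser 2005: §2.3 Thm. 2.3.2; §10.1 (10.1.2), Lemma 10.1.1–10.1.3, Cor. 10.1.4.
* [CarlsonMullerStachPeters2017] J. Carlson, S. Müller-Stach, C. Peters, *Period Mappings and Period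
  Domains*, 2nd ed., CUP 2017: §16.1, Thm. 16.1.5 (type AIII).
* [Deligne1982HodgeCycles] P. Deligne, *Hodge cycles on abelian varieties*, LNM 900: proof of
  Thm. 4.8, p. 49.
* [vanGeemen1994HodgeAV] B. van Geemen, LNM 1594: 5.5–5.10.
-/

noncomputable section

open scoped InnerProductSpace ComplexOrder
open Module

namespace Literature.AlgebraicGeometry.Motives

section Domain

variable (p q : ℕ)

/-! ### The standard Hermitian space of signature `(p, q)` and its positive subspaces -/

/-- The standard Hermitian form of signature `(p, q)` on `ℂᵖ × ℂ^q`: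
`H₀((x₁, x₂), (y₁, y₂)) = ⟪x₁, y₁⟫ - ⟪x₂, y₂⟫` (conjugate-linear in the first variable, Mathlib's
convention for `inner`; the matrix `diag(I_p, -I_q)` of loc. cit.).
[cite: GohbergLancasterRodman2005, §10.1 (10.1.2)] -/
def stdHermitianForm (x y : EuclideanSpace ℂ (Fin p) × EuclideanSpace ℂ (Fin q)) : ℂ :=
  ⟪x.1, y.1⟫_ℂ - ⟪x.2, y.2⟫_ℂ

/-- `Re H₀(x, x) = ‖x₁‖² - ‖x₂‖²`. [cite: GohbergLancasterRodman2005, §10.1 (10.1.5)] -/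
theorem re_stdHermitianForm_self (x : EuclideanSpace ℂ (Fin p) × EuclideanSpace ℂ (Fin q)) :
    (stdHermitianForm p q x x).re = ‖x.1‖ ^ 2 - ‖x.2‖ ^ 2 := by
  simp only [stdHermitianForm, Complex.sub_re]
  rw [← inner_self_eq_norm_sq (𝕜 := ℂ), ← inner_self_eq_norm_sq (𝕜 := ℂ)]
  rfl

/-- `H₀(x, x) > 0` iff `‖x₂‖ < ‖x₁‖`. [cite: GohbergLancasterRodman2005, §10.1 (10.1.5)] -/
theorem re_stdHermitianForm_self_pos_iff (x : EuclideanSpace ℂ (Fin p) × EuclideanSpace ℂ (Fin q)) :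
    0 < (stdHermitianForm p q x x).re ↔ ‖x.2‖ < ‖x.1‖ := by
  rw [re_stdHermitianForm_self, sub_pos, sq_lt_sq, abs_norm, abs_norm]

/-- A subspace `M ⊆ ℂᵖ × ℂ^q` is **`H₀`-positive** if `H₀(x, x) > 0` for every non-zero `x ∈ M`.
[cite: GohbergLancasterRodman2005, §2.3 (definition before Thm. 2.3.2)] -/
def IsPositiveSubspace
    (M : Submodule ℂ (EuclideanSpace ℂ (Fin p) × EuclideanSpace ℂ (Fin q))) : Prop :=
  ∀ x ∈ M, x ≠ 0 → 0 < (stdHermitianForm p q x x).re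

/-- A **positive `p`-plane**: an `H₀`-positive subspace of the maximal possible dimension `p`
(a point of the Grassmannian model of `SU(p, q)/S(U(p) × U(q))`).
[cite: GohbergLancasterRodman2005, §2.3 Thm. 2.3.2 and §10.1 Cor. 10.1.4] -/
def IsPositivePlane
    (M : Submodule ℂ (EuclideanSpace ℂ (Fin p) × EuclideanSpace ℂ (Fin q))) : Prop :=
  IsPositiveSubspace p q M ∧ finrank ℂ M = p

/-- On a positive subspace the first projection `(x₁, x₂) ↦ x₁` is injective (a non-zero vector
with `x₁ = 0` would have `H₀(x, x) = -‖x₂‖² ≤ 0`).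
[cite: GohbergLancasterRodman2005, §10.1, proof of Lemma 10.1.1] -/
theorem fst_comp_subtype_injective_of_isPositiveSubspace
    {M : Submodule ℂ (EuclideanSpace ℂ (Fin p) × EuclideanSpace ℂ (Fin q))}
    (hM : IsPositiveSubspace p q M) :
    Function.Injective
      ((LinearMap.fst ℂ (EuclideanSpace ℂ (Fin p)) (EuclideanSpace ℂ (Fin q))).comp M.subtype) := by
  rw [← LinearMap.ker_eq_bot, LinearMap.ker_eq_bot']
  rintro ⟨x, hx⟩ h0
  simp only [LinearMap.coe_comp, Function.comp_apply, Submodule.coe_subtype, LinearMap.fst_apply] at h0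
  by_contra hne
  have hx0 : x ≠ 0 := fun h => hne (Subtype.ext h)
  have h := (re_stdHermitianForm_self_pos_iff p q x).1 (hM x hx hx0)
  rw [h0, norm_zero] at h
  exact absurd h (not_lt.2 (norm_nonneg _))

/-- **Positive subspaces have dimension at most `p`** (the number of positive eigenvalues of
`diag(I_p, -I_q)`). [cite: GohbergLancasterRodman2005, §2.3 Thm. 2.3.2] -/
theorem finrank_le_of_isPositiveSubspace
    {M : Submodule ℂ (EuclideanSpace ℂ (Fin p) × EuclideanSpace ℂ (Fin q))}
    (hM : IsPositiveSubspace p q M) : finrank ℂ M ≤ p := by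
  have h := LinearMap.finrank_le_finrank_of_injective
    (fst_comp_subtype_injective_of_isPositiveSubspace p q hM)
  rwa [finrank_euclideanSpace_fin] at h

/-! ### The domain of strict contractions = the open unit operator ball -/

/-- The **unitary period domain** of signature `(p, q)`: the continuous linear maps
`Z : ℂᵖ → ℂ^q` that are pointwise strict contractions, `‖Z v‖ < ‖v‖` for `v ≠ 0` — the bounded
realisation `I_{p,q} = {Z : 1 - Z^* Z > 0}` of `SU(p, q)/S(U(p) × U(q))`.
[cite: CarlsonMullerStachPeters2017, Thm. 16.1.5 (type AIII)]
[cite: GohbergLancasterRodman2005, §10.1 Lemma 10.1.2] -/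
def unitaryPeriodDomain : Set (EuclideanSpace ℂ (Fin p) →L[ℂ] EuclideanSpace ℂ (Fin q)) :=
  {Z | ∀ v, v ≠ 0 → ‖Z v‖ < ‖v‖}

variable {p q} in
/-- Membership in the unitary period domain, unfolded. [cite: GohbergLancasterRodman2005, §10.1 Lemma 10.1.2] -/
theorem mem_unitaryPeriodDomain_iff {Z : EuclideanSpace ℂ (Fin p) →L[ℂ] EuclideanSpace ℂ (Fin q)} :
    Z ∈ unitaryPeriodDomain p q ↔ ∀ v, v ≠ 0 → ‖Z v‖ < ‖v‖ :=
  Iff.rfl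

/-- `0` (the base point `V₊^{1,0} = ℂᵖ × 0`) lies in the domain. [cite: GohbergLancasterRodman2005, §2.3 Thm. 2.3.2 (proof)] -/
theorem zero_mem_unitaryPeriodDomain :
    (0 : EuclideanSpace ℂ (Fin p) →L[ℂ] EuclideanSpace ℂ (Fin q)) ∈ unitaryPeriodDomain p q :=
  fun v hv => by simpa using hv

/-- **The domain of pointwise strict contractions is the open unit ball of the operator norm**
(`‖Z‖ < 1`; the inclusion `⊆` uses that the operator norm of a map out of the finite-dimensional
space `ℂᵖ` is attained on the compact unit sphere).
[cite: GohbergLancasterRodman2005, §10.1 Lemma 10.1.2 ("strict contraction, i.e. ‖K‖ < 1")] -/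
theorem unitaryPeriodDomain_eq_ball :
    unitaryPeriodDomain p q =
      Metric.ball (0 : EuclideanSpace ℂ (Fin p) →L[ℂ] EuclideanSpace ℂ (Fin q)) 1 := by
  ext Z
  simp only [Metric.mem_ball, dist_zero_right]
  constructor
  · intro hZ
    rcases subsingleton_or_nontrivial (EuclideanSpace ℂ (Fin p)) with hE | hE
    · have h0 : Z = 0 := by
        ext v
        simp [Subsingleton.elim v 0]
      rw [h0, norm_zero]
      exact one_pos
    · obtain ⟨w, hw⟩ := exists_ne (0 : EuclideanSpace ℂ (Fin p))
      have hsph : ∀ v : EuclideanSpace ℂ (Fin p), v ≠ 0 →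
          ((‖v‖ : ℂ)⁻¹ • v) ∈ Metric.sphere (0 : EuclideanSpace ℂ (Fin p)) 1 := fun v hv => by
        rw [mem_sphere_zero_iff_norm, norm_smul, norm_inv, Complex.norm_real, Real.norm_eq_abs,
          abs_norm, inv_mul_cancel₀ (norm_pos_iff.2 hv).ne']
      obtain ⟨v₀, hv₀, hmax⟩ := (isCompact_sphere (0 : EuclideanSpace ℂ (Fin p)) 1).exists_isMaxOn
        ⟨_, hsph w hw⟩ (Z.continuous.norm.continuousOn)
      have hv₀1 : ‖v₀‖ = 1 := by simpa using hv₀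
      have hv₀0 : v₀ ≠ 0 := by
        rintro rfl
        simp at hv₀1
      calc ‖Z‖ ≤ ‖Z v₀‖ := by
            refine Z.opNorm_le_bound (norm_nonneg _) fun v => ?_
            rcases eq_or_ne v 0 with rfl | hv
            · simp
            · have hvn : 0 < ‖v‖ := norm_pos_iff.2 hv
              have h := isMaxOn_iff.1 hmax _ (hsph v hv)
              rw [map_smul, norm_smul, norm_inv, Complex.norm_real, Real.norm_eq_abs, abs_norm,
                inv_mul_le_iff₀ hvn] at h
              rwa [mul_comm] at h
        _ < ‖v₀‖ := hZ v₀ hv₀0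
        _ = 1 := hv₀1
  · intro hZ v hv
    calc ‖Z v‖ ≤ ‖Z‖ * ‖v‖ := Z.le_opNorm v
      _ < 1 * ‖v‖ := mul_lt_mul_of_pos_right hZ (norm_pos_iff.2 hv)
      _ = ‖v‖ := one_mul _

/-- The domain is open. [cite: CarlsonMullerStachPeters2017, Thm. 16.1.5 (type AIII)] -/
theorem isOpen_unitaryPeriodDomain : IsOpen (unitaryPeriodDomain p q) := by
  rw [unitaryPeriodDomain_eq_ball]
  exact Metric.isOpen_ball

/-- The domain is convex (it is a ball of a normed space). [cite: CarlsonMullerStachPeters2017, Thm. 16.1.5 (type AIII)] -/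
theorem convex_unitaryPeriodDomain : Convex ℝ (unitaryPeriodDomain p q) := by
  rw [unitaryPeriodDomain_eq_ball]
  exact convex_ball _ _

/-- The domain is non-empty. [cite: CarlsonMullerStachPeters2017, Thm. 16.1.5 (type AIII)] -/
theorem unitaryPeriodDomain_nonempty : (unitaryPeriodDomain p q).Nonempty :=
  ⟨0, zero_mem_unitaryPeriodDomain p q⟩

/-- **The unitary period domain is path connected** (Deligne's "`X⁺` … connected", the point of
this file). [cite: Deligne1982HodgeCycles, proof of Thm. 4.8, p. 49]
[cite: CarlsonMullerStachPeters2017, Thm. 16.1.5 (type AIII)] -/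
theorem isPathConnected_unitaryPeriodDomain : IsPathConnected (unitaryPeriodDomain p q) :=
  (convex_unitaryPeriodDomain p q).isPathConnected (unitaryPeriodDomain_nonempty p q)

/-- The unitary period domain is connected. [cite: Deligne1982HodgeCycles, proof of Thm. 4.8, p. 49] -/
theorem isConnected_unitaryPeriodDomain : IsConnected (unitaryPeriodDomain p q) :=
  (isPathConnected_unitaryPeriodDomain p q).isConnected

end Domain

/-! ### Positive `p`-planes are the graphs of the strict contractions -/

section Graph

variable {p q : ℕ}

/-- The graph `{(v, Z v)} ⊆ ℂᵖ × ℂ^q` of `Z` (`Range [I_p; K]` of loc. cit.).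
[cite: GohbergLancasterRodman2005, §10.1 Cor. 10.1.4 (10.1.9)] -/
abbrev graphPlane (Z : EuclideanSpace ℂ (Fin p) →L[ℂ] EuclideanSpace ℂ (Fin q)) :
    Submodule ℂ (EuclideanSpace ℂ (Fin p) × EuclideanSpace ℂ (Fin q)) :=
  LinearMap.graph (Z : EuclideanSpace ℂ (Fin p) →ₗ[ℂ] EuclideanSpace ℂ (Fin q))

/-- Membership in the graph. [cite: GohbergLancasterRodman2005, §10.1 (10.1.9)] -/
theorem mem_graphPlane_iff (Z : EuclideanSpace ℂ (Fin p) →L[ℂ] EuclideanSpace ℂ (Fin q))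
    (x : EuclideanSpace ℂ (Fin p) × EuclideanSpace ℂ (Fin q)) : x ∈ graphPlane Z ↔ x.2 = Z x.1 :=
  LinearMap.mem_graph_iff _ x

/-- A graph has dimension `p`. [cite: GohbergLancasterRodman2005, §10.1 Cor. 10.1.4] -/
theorem finrank_graphPlane (Z : EuclideanSpace ℂ (Fin p) →L[ℂ] EuclideanSpace ℂ (Fin q)) :
    finrank ℂ (graphPlane Z) = p := by
  have hinj : Function.Injective
      (LinearMap.id.prod (Z : EuclideanSpace ℂ (Fin p) →ₗ[ℂ] EuclideanSpace ℂ (Fin q))) :=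
    fun v w h => congrArg Prod.fst h
  have e : graphPlane Z ≃ₗ[ℂ] EuclideanSpace ℂ (Fin p) :=
    (LinearEquiv.ofEq _ _ (LinearMap.graph_eq_range_prod _)).trans
      (LinearEquiv.ofInjective _ hinj).symm
  rw [e.finrank_eq, finrank_euclideanSpace_fin]

/-- **The graph of `Z` is `H₀`-positive iff `Z` is a pointwise strict contraction**
(`H₀((v, Zv), (v, Zv)) = ‖v‖² - ‖Z v‖²`). [cite: GohbergLancasterRodman2005, §10.1 Lemma 10.1.2] -/
theorem isPositiveSubspace_graphPlane_iff (Z : EuclideanSpace ℂ (Fin p) →L[ℂ] EuclideanSpace ℂ (Fin q)) :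
    IsPositiveSubspace p q (graphPlane Z) ↔ Z ∈ unitaryPeriodDomain p q := by
  constructor
  · intro h v hv
    have hmem : (v, Z v) ∈ graphPlane Z := (mem_graphPlane_iff Z _).2 rfl
    have hne : (v, Z v) ≠ 0 := fun h0 => hv (Prod.mk_eq_zero.1 h0).1
    exact (re_stdHermitianForm_self_pos_iff p q (v, Z v)).1 (h _ hmem hne)
  · intro h x hx hx0
    rw [mem_graphPlane_iff] at hx
    rw [re_stdHermitianForm_self_pos_iff, hx]
    refine h x.1 fun h1 => hx0 ?_
    ext1
    · exact h1
    · rw [hx, h1, map_zero]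
      rfl

/-- **The graph of `Z` is a positive `p`-plane iff `Z ∈ unitaryPeriodDomain p q`.**
[cite: GohbergLancasterRodman2005, §10.1 Lemma 10.1.2 and Cor. 10.1.4] -/
theorem isPositivePlane_graphPlane_iff (Z : EuclideanSpace ℂ (Fin p) →L[ℂ] EuclideanSpace ℂ (Fin q)) :
    IsPositivePlane p q (graphPlane Z) ↔ Z ∈ unitaryPeriodDomain p q := by
  rw [IsPositivePlane, isPositiveSubspace_graphPlane_iff, and_iff_left (finrank_graphPlane Z)]

/-- Graphs determine the map (uniqueness in Cor. 10.1.4).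
[cite: GohbergLancasterRodman2005, §10.1 Lemma 10.1.3 and Cor. 10.1.4] -/
theorem graphPlane_injective :
    Function.Injective
      (graphPlane : (EuclideanSpace ℂ (Fin p) →L[ℂ] EuclideanSpace ℂ (Fin q)) →
        Submodule ℂ (EuclideanSpace ℂ (Fin p) × EuclideanSpace ℂ (Fin q))) := by
  intro Z Z' h
  refine ContinuousLinearMap.ext fun v => ?_
  have hv : (v, Z v) ∈ graphPlane Z' := h ▸ (mem_graphPlane_iff Z _).2 rfl
  exact (mem_graphPlane_iff Z' _).1 hv

/-- **Every positive `p`-plane is a graph**: the first projection is injective on it (positivity),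
hence bijective onto `ℂᵖ` (dimension `p`), and the plane is the graph of
`x₁ ↦ x₂ ∘ (x₁|_M)⁻¹`. [cite: GohbergLancasterRodman2005, §10.1 Lemma 10.1.1–10.1.2 and Cor. 10.1.4] -/
theorem exists_graphPlane_eq
    {M : Submodule ℂ (EuclideanSpace ℂ (Fin p) × EuclideanSpace ℂ (Fin q))}
    (hM : IsPositivePlane p q M) :
    ∃ Z : EuclideanSpace ℂ (Fin p) →L[ℂ] EuclideanSpace ℂ (Fin q), graphPlane Z = M := by
  obtain ⟨hpos, hdim⟩ := hM
  set π₁ := (LinearMap.fst ℂ (EuclideanSpace ℂ (Fin p)) (EuclideanSpace ℂ (Fin q))).comp M.subtype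
    with hπ₁
  have hinj : Function.Injective π₁ := fst_comp_subtype_injective_of_isPositiveSubspace p q hpos
  have hfd : finrank ℂ M = finrank ℂ (EuclideanSpace ℂ (Fin p)) := by
    rw [hdim, finrank_euclideanSpace_fin]
  let e : M ≃ₗ[ℂ] EuclideanSpace ℂ (Fin p) := LinearMap.linearEquivOfInjective π₁ hinj hfd
  have he : ∀ m : M, e m = (m : EuclideanSpace ℂ (Fin p) × EuclideanSpace ℂ (Fin q)).1 := fun m =>
    LinearMap.linearEquivOfInjective_apply hinj hfd m
  let Zl : EuclideanSpace ℂ (Fin p) →ₗ[ℂ] EuclideanSpace ℂ (Fin q) :=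
    ((LinearMap.snd ℂ (EuclideanSpace ℂ (Fin p)) (EuclideanSpace ℂ (Fin q))).comp M.subtype).comp
      e.symm.toLinearMap
  have hZl : ∀ v, Zl v = ((e.symm v : M) : EuclideanSpace ℂ (Fin p) × EuclideanSpace ℂ (Fin q)).2 :=
    fun v => rfl
  refine ⟨LinearMap.toContinuousLinearMap Zl, ?_⟩
  ext x
  rw [mem_graphPlane_iff, LinearMap.coe_toContinuousLinearMap', hZl]
  constructor
  · intro hx
    have h1 : ((e.symm x.1 : M) : EuclideanSpace ℂ (Fin p) × EuclideanSpace ℂ (Fin q)).1 = x.1 := by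
      rw [← he, LinearEquiv.apply_symm_apply]
    have hxe : ((e.symm x.1 : M) : EuclideanSpace ℂ (Fin p) × EuclideanSpace ℂ (Fin q)) = x :=
      Prod.ext h1 hx.symm
    rw [← hxe]
    exact (e.symm x.1).2
  · intro hx
    have hsymm : e.symm x.1 = ⟨x, hx⟩ := by
      rw [LinearEquiv.symm_apply_eq, he]
    rw [hsymm]

/-- Every positive `p`-plane is the graph of a UNIQUE strict contraction.
[cite: GohbergLancasterRodman2005, §10.1 Cor. 10.1.4] -/
theorem existsUnique_graphPlane_eq
    {M : Submodule ℂ (EuclideanSpace ℂ (Fin p) × EuclideanSpace ℂ (Fin q))}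
    (hM : IsPositivePlane p q M) :
    ∃! Z : EuclideanSpace ℂ (Fin p) →L[ℂ] EuclideanSpace ℂ (Fin q),
      Z ∈ unitaryPeriodDomain p q ∧ graphPlane Z = M := by
  obtain ⟨Z, hZ⟩ := exists_graphPlane_eq hM
  refine ⟨Z, ⟨(isPositivePlane_graphPlane_iff Z).1 (hZ ▸ hM), hZ⟩, fun Z' hZ' => graphPlane_injective ?_⟩
  rw [hZ'.2, hZ]

variable (p q) in
/-- **The Grassmannian model of the type AIII domain**: `Z ↦ graph Z` is a bijection from the
unitary period domain onto the positive `p`-planes of the standard Hermitian space of signature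
`(p, q)`. [cite: GohbergLancasterRodman2005, §10.1 Cor. 10.1.4 (with Lemma 10.1.2)]
[cite: CarlsonMullerStachPeters2017, Thm. 16.1.5 (type AIII)] -/
def unitaryPeriodDomainEquiv :
    unitaryPeriodDomain p q ≃
      {M : Submodule ℂ (EuclideanSpace ℂ (Fin p) × EuclideanSpace ℂ (Fin q)) //
        IsPositivePlane p q M} where
  toFun Z := ⟨graphPlane Z.1, (isPositivePlane_graphPlane_iff _).2 Z.2⟩
  invFun M := ⟨(exists_graphPlane_eq M.2).choose,
    (isPositivePlane_graphPlane_iff _).1 ((exists_graphPlane_eq M.2).choose_spec.symm ▸ M.2)⟩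
  left_inv Z := Subtype.ext (graphPlane_injective (exists_graphPlane_eq ((isPositivePlane_graphPlane_iff _).2 Z.2)).choose_spec)
  right_inv M := Subtype.ext (exists_graphPlane_eq M.2).choose_spec

/-- The value of `unitaryPeriodDomainEquiv` is the graph. [cite: GohbergLancasterRodman2005, §10.1 Cor. 10.1.4] -/
@[simp]
theorem coe_unitaryPeriodDomainEquiv_apply (Z : unitaryPeriodDomain p q) :
    ((unitaryPeriodDomainEquiv p q Z : {M : Submodule ℂ (EuclideanSpace ℂ (Fin p) × EuclideanSpace ℂ (Fin q)) //
        IsPositivePlane p q M}) : Submodule ℂ _) = graphPlane Z.1 :=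
  rfl

/-- Positive `p`-planes exist (e.g. `ℂᵖ × 0`), so `p` IS the maximal dimension of a positive
subspace. [cite: GohbergLancasterRodman2005, §2.3 Thm. 2.3.2] -/
theorem exists_isPositivePlane (p q : ℕ) :
    ∃ M : Submodule ℂ (EuclideanSpace ℂ (Fin p) × EuclideanSpace ℂ (Fin q)), IsPositivePlane p q M :=
  ⟨graphPlane (0 : EuclideanSpace ℂ (Fin p) →L[ℂ] EuclideanSpace ℂ (Fin q)),
    (isPositivePlane_graphPlane_iff _).2 (zero_mem_unitaryPeriodDomain p q)⟩

end Graph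

/-! ### Matrix form: `I_{p,q} = {K : 1 - Kᴴ K > 0}` -/

section MatrixForm

open Matrix

variable {p q : ℕ}

/-- Hermitian quadratic forms are real: `Im (ξ̄ · L ξ) = 0` for `L` Hermitian (re-proved here in
eight lines rather than importing the Loewner-matrix files that also record it). [folklore] -/
theorem im_star_dotProduct_mulVec_eq_zero {m : Type*} [Fintype m] {L : Matrix m m ℂ}
    (hL : L.IsHermitian) (ξ : m → ℂ) : (star ξ ⬝ᵥ (L *ᵥ ξ)).im = 0 := by
  have h : star (star ξ ⬝ᵥ (L *ᵥ ξ)) = star ξ ⬝ᵥ (L *ᵥ ξ) := by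
    calc star (star ξ ⬝ᵥ (L *ᵥ ξ)) = star (L *ᵥ ξ) ⬝ᵥ ξ := by rw [star_dotProduct, star_star]
      _ = (star ξ ᵥ* Lᴴ) ⬝ᵥ ξ := by rw [star_mulVec]
      _ = star ξ ⬝ᵥ (Lᴴ *ᵥ ξ) := (dotProduct_mulVec _ _ _).symm
      _ = star ξ ⬝ᵥ (L *ᵥ ξ) := by rw [hL.eq]
  rw [Complex.star_def] at h
  exact Complex.conj_eq_iff_im.mp h

/-- The continuous linear map `ℂᵖ → ℂ^q`, `v ↦ K v`, of a `q × p` matrix (Euclidean norms on both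
sides). [cite: GohbergLancasterRodman2005, §10.1 (10.1.3)] -/
abbrev euclideanCLMOfMatrix (K : Matrix (Fin q) (Fin p) ℂ) :
    EuclideanSpace ℂ (Fin p) →L[ℂ] EuclideanSpace ℂ (Fin q) :=
  LinearMap.toContinuousLinearMap (Matrix.toEuclideanLin K)

/-- `euclideanCLMOfMatrix K v = K v`. [cite: GohbergLancasterRodman2005, §10.1 (10.1.3)] -/
theorem euclideanCLMOfMatrix_apply (K : Matrix (Fin q) (Fin p) ℂ) (v : EuclideanSpace ℂ (Fin p)) :
    euclideanCLMOfMatrix K v = WithLp.toLp 2 (K.mulVec v.ofLp) :=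
  rfl

/-- `‖v‖² = Re (v̄ · v)` on `ℂⁿ`. [folklore] -/
theorem norm_sq_eq_re_star_dotProduct {n : ℕ} (v : EuclideanSpace ℂ (Fin n)) :
    ‖v‖ ^ 2 = (star v.ofLp ⬝ᵥ v.ofLp).re := by
  rw [← inner_self_eq_norm_sq (𝕜 := ℂ), EuclideanSpace.inner_eq_star_dotProduct, dotProduct_comm]
  rfl

/-- The quadratic form of `1 - Kᴴ K`: `Re (v̄ · (1 - Kᴴ K) v) = ‖v‖² - ‖K v‖²`.
[cite: GohbergLancasterRodman2005, §10.1 (10.1.5)] -/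
theorem re_star_dotProduct_one_sub_conjTranspose_mul_mulVec (K : Matrix (Fin q) (Fin p) ℂ)
    (v : Fin p → ℂ) :
    (star v ⬝ᵥ (1 - K.conjTranspose * K).mulVec v).re =
      ‖WithLp.toLp 2 v‖ ^ 2 - ‖WithLp.toLp 2 (K.mulVec v)‖ ^ 2 := by
  rw [norm_sq_eq_re_star_dotProduct, norm_sq_eq_re_star_dotProduct, ← Complex.sub_re]
  congr 1
  rw [sub_mulVec, one_mulVec, dotProduct_sub, ← mulVec_mulVec, dotProduct_mulVec (star v) Kᴴ,
    star_mulVec]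

/-- **Matrix form of the domain**: `v ↦ K v` is a pointwise strict contraction iff `1 - Kᴴ K` is
positive definite, i.e. `unitaryPeriodDomain p q` is the type AIII bounded domain
`I_{p,q} = {K ∈ M_{q×p}(ℂ) : 1 - K^* K > 0}`.
[cite: CarlsonMullerStachPeters2017, Thm. 16.1.5 (type AIII)]
[cite: GohbergLancasterRodman2005, §10.1 Lemma 10.1.2] -/
theorem euclideanCLMOfMatrix_mem_unitaryPeriodDomain_iff (K : Matrix (Fin q) (Fin p) ℂ) :
    euclideanCLMOfMatrix K ∈ unitaryPeriodDomain p q ↔ (1 - K.conjTranspose * K).PosDef := by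
  have hH : (1 - K.conjTranspose * K).IsHermitian :=
    Matrix.isHermitian_one.sub (Matrix.isHermitian_conjTranspose_mul_self K)
  rw [Matrix.posDef_iff_dotProduct_mulVec, and_iff_right hH, mem_unitaryPeriodDomain_iff]
  constructor
  · intro h x hx
    have hx' : WithLp.toLp 2 x ≠ (0 : EuclideanSpace ℂ (Fin p)) := fun h0 =>
      hx (by simpa using congrArg WithLp.ofLp h0)
    have hlt := h _ hx'
    rw [euclideanCLMOfMatrix_apply, WithLp.ofLp_toLp, ← sq_lt_sq₀ (norm_nonneg _) (norm_nonneg _),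
      ← sub_pos, ← re_star_dotProduct_one_sub_conjTranspose_mul_mulVec] at hlt
    rw [Complex.lt_def]
    exact ⟨by simpa using hlt, by simp [im_star_dotProduct_mulVec_eq_zero hH x]⟩
  · intro h v hv
    have hv' : v.ofLp ≠ 0 := fun h0 => hv (by simpa using congrArg (WithLp.toLp 2) h0)
    have hre : 0 < (star v.ofLp ⬝ᵥ (1 - K.conjTranspose * K).mulVec v.ofLp).re := by
      simpa using (Complex.lt_def.1 (h hv')).1
    rw [re_star_dotProduct_one_sub_conjTranspose_mul_mulVec, sub_pos,
      sq_lt_sq₀ (norm_nonneg _) (norm_nonneg _), WithLp.toLp_ofLp] at hre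
    rwa [euclideanCLMOfMatrix_apply]

end MatrixForm

end Literature.AlgebraicGeometry.Motives

end
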